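import Mathlib.RingTheory.DedekindDomain.AdicValuation
import Mathlib.Data.Int.WithZero
import Mathlib.Data.Nat.Prime.Int
import Mathlib.NumberTheory.NumberField.Basic
import Mathlib.RingTheory.Ideal.Pointwise
import Literature.NumberTheory.EllipticCurves.X1ElevenDescentLocal
import HarnessLib

/-!
# The `5`-descent on `X₁(11)`, IV-a: the `Q`-adic valuation of a number field at a prime stable
# under an automorphism; inertia elements are inertial for it; restriction to `ℚ`

Auxiliary file (theorems and two real definitions) for the global half of the explicit
Eisenstein `5`-descent on `X₁(11)` (`X1ElevenDescentGalois`; overview in `X1ElevenKummerValues`).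
For a number field `F`, a maximal ideal `Q ⊆ 𝓞 F` and the `Q`-adic valuation read in `ℝ≥0`
(`adicValNNReal Q`, Mathlib's `HeightOneSpectrum.valuation` composed with
`WithZeroMulInt.toNNReal`, the shape used by the tree's `GoodReductionInertia` /
`X1ElevenDescentLocal`):

* `adicValNNReal_smul_eq` — an automorphism `τ` of `F` with `τ(Q) = Q` preserves the valuation
  (`τ(Qⁿ) = Qⁿ`, and `v_Q(r) ≤ e⁻ⁿ ↔ r ∈ Qⁿ`, Mathlib `intValuation_le_pow_iff_mem`);
* `adicValNNReal_smul_sub_lt_one` — an element of the inertia group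
  (`τ x - x ∈ Q` on `𝓞 F`) is **inertial for the valuation**: `w (τ z - z) < 1` whenever
  `w z ≤ 1` (write `z = n/d`, `d ∉ Q`, Mathlib `exists_primeCompl_mul_eq_of_integer`);
* `val_intCast_lt_one_iff_dvd`, `not_dvd_den_and_dvd_of_val` — for any valuation `w` of a field
  of characteristic `0` with `w p < 1` for a prime `p`: `w n < 1 ↔ p ∣ n` on `ℤ` (Bézout), and
  for `x ∈ ℚ` with `w x ≤ 1`, `w (x - c) < 1`: `p ∤ den x` and `p ∣ num x - c·den x`.

All of this is standard (valuations attached to prime ideals, decomposition and inertia groups: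
Neukirch, *Algebraic Number Theory*, Ch. I §9, §11 and Ch. II §3, §9). [folklore]

## References

* [NeukirchANT1999] J. Neukirch, *Algebraic Number Theory*, Grundlehren 322, Springer (1999),
  Ch. I §9 (Hilbert's ramification theory), §11 (localisation, `v_𝔭`), Ch. II §3 (valuations).
* [Mazur1977] B. Mazur, *Modular curves and the Eisenstein ideal*, Publ. Math. IHÉS 47 (1977),
  Ch. III §3 (the descent this file serves).

## Design

`adicValNNReal` uses base `2` for `toNNReal` (any `b > 1` gives an equivalent valuation; only
`≤ 1` / `< 1` / equalities are used downstream).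
-/

noncomputable section

open scoped Classical NNReal
open NumberField IsDedekindDomain WithZeroMulInt

namespace Literature.NumberTheory.EllipticCurves.X1Eleven

section NumberFieldValuation

variable {F : Type*} [Field F] [NumberField F]

/-- The point of `Spec 𝓞 F` given by a maximal ideal `Q` (non-zero since `𝓞 F` is not a field).
[folklore] -/
def spectrumOfMaximal (Q : Ideal (𝓞 F)) [hQ : Q.IsMaximal] : HeightOneSpectrum (𝓞 F) :=
  ⟨Q, hQ.isPrime, hQ.ne_bot_of_isIntegral_int⟩

/-- **The `Q`-adic valuation of `F` with values in `ℝ≥0`** (`2^{-ord_Q}`). [folklore] -/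
def adicValNNReal (Q : Ideal (𝓞 F)) [Q.IsMaximal] : Valuation F ℝ≥0 :=
  ((spectrumOfMaximal Q).valuation F).map (toNNReal (two_ne_zero))
    (toNNReal_strictMono one_lt_two).monotone

variable (Q : Ideal (𝓞 F)) [Q.IsMaximal]

/-- Unfolding `adicValNNReal`. [folklore] -/
theorem adicValNNReal_apply (z : F) :
    adicValNNReal Q z = toNNReal two_ne_zero ((spectrumOfMaximal Q).valuation F z) := rfl

/-- `w z ≤ 1 ↔ v_Q z ≤ 1`. [folklore] -/
theorem adicValNNReal_le_one_iff (z : F) :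
    adicValNNReal Q z ≤ 1 ↔ (spectrumOfMaximal Q).valuation F z ≤ 1 := by
  rw [adicValNNReal_apply, toNNReal_le_one_iff one_lt_two]

/-- `w z < 1 ↔ v_Q z < 1`. [folklore] -/
theorem adicValNNReal_lt_one_iff (z : F) :
    adicValNNReal Q z < 1 ↔ (spectrumOfMaximal Q).valuation F z < 1 := by
  rw [adicValNNReal_apply, toNNReal_lt_one_iff one_lt_two]

/-- Integers have `w ≤ 1`. [folklore] -/
theorem adicValNNReal_coe_le_one (r : 𝓞 F) : adicValNNReal Q (r : F) ≤ 1 := by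
  rw [adicValNNReal_le_one_iff]
  exact (spectrumOfMaximal Q).valuation_le_one r

/-- `w r < 1 ↔ r ∈ Q` for `r ∈ 𝓞 F`. [folklore] -/
theorem adicValNNReal_coe_lt_one_iff (r : 𝓞 F) : adicValNNReal Q (r : F) < 1 ↔ r ∈ Q := by
  rw [adicValNNReal_lt_one_iff]
  exact (spectrumOfMaximal Q).valuation_lt_one_iff_mem r

/-! ### Invariance under an automorphism preserving `Q` -/

omit [NumberField F] [Q.IsMaximal] in
/-- A ring automorphism of `𝓞 F` preserving `Q` preserves `Qⁿ`. [folklore] -/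
theorem mem_pow_iff_of_ringEquiv (e : 𝓞 F ≃+* 𝓞 F) (he : ∀ r, e r ∈ Q ↔ r ∈ Q) (n : ℕ)
    (r : 𝓞 F) : e r ∈ Q ^ n ↔ r ∈ Q ^ n := by
  have hmap : ∀ (g : 𝓞 F ≃+* 𝓞 F), (∀ r, g r ∈ Q ↔ r ∈ Q) → Ideal.map (g : 𝓞 F →+* 𝓞 F) Q = Q := by
    intro g hg
    apply le_antisymm
    · rw [Ideal.map_le_iff_le_comap]
      intro r hr
      exact (hg r).mpr hr
    · intro r hr
      have : r = g (g.symm r) := (g.apply_symm_apply r).symm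
      rw [this]
      exact Ideal.mem_map_of_mem _ ((hg _).mp (by rw [g.apply_symm_apply]; exact hr))
  have hpow : ∀ (g : 𝓞 F ≃+* 𝓞 F), (∀ r, g r ∈ Q ↔ r ∈ Q) →
      Ideal.map (g : 𝓞 F →+* 𝓞 F) (Q ^ n) = Q ^ n := fun g hg => by
    rw [Ideal.map_pow, hmap g hg]
  have he' : ∀ r, e.symm r ∈ Q ↔ r ∈ Q := fun r => by
    rw [← he (e.symm r), e.apply_symm_apply]
  constructor
  · intro h
    have := Ideal.mem_map_of_mem (e.symm : 𝓞 F →+* 𝓞 F) h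
    rw [hpow e.symm he'] at this
    simpa using this
  · intro h
    have := Ideal.mem_map_of_mem (e : 𝓞 F →+* 𝓞 F) h
    rwa [hpow e he] at this

/-- A ring automorphism of `𝓞 F` preserving `Q` preserves the `Q`-adic valuation on `𝓞 F`.
[folklore] -/
theorem intValuation_ringEquiv_eq (e : 𝓞 F ≃+* 𝓞 F) (he : ∀ r, e r ∈ Q ↔ r ∈ Q) (r : 𝓞 F) :
    (spectrumOfMaximal Q).intValuation (e r) = (spectrumOfMaximal Q).intValuation r := by
  set v := spectrumOfMaximal Q
  by_cases hr : r = 0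
  · subst hr; simp
  have her : e r ≠ 0 := (map_ne_zero_iff e e.injective).mpr hr
  -- both values are `exp (-m)`; compare through `≤ exp (-n) ↔ ∈ Qⁿ`
  have key : ∀ n : ℕ, v.intValuation (e r) ≤ WithZero.exp (-(n : ℤ)) ↔
      v.intValuation r ≤ WithZero.exp (-(n : ℤ)) := fun n => by
    rw [v.intValuation_le_pow_iff_mem, v.intValuation_le_pow_iff_mem]
    exact mem_pow_iff_of_ringEquiv Q e he n r
  obtain ⟨a, ha⟩ : ∃ a : ℕ, v.intValuation (e r) = WithZero.exp (-(a : ℤ)) := by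
    rw [v.intValuation_if_neg her]; exact ⟨_, rfl⟩
  obtain ⟨b, hb⟩ : ∃ b : ℕ, v.intValuation r = WithZero.exp (-(b : ℤ)) := by
    rw [v.intValuation_if_neg hr]; exact ⟨_, rfl⟩
  rw [ha, hb] at key ⊢
  have h1 := (key a).mp le_rfl
  have h2 := (key b).mpr le_rfl
  exact le_antisymm h2 h1

/-- **An automorphism of `F` preserving `Q` preserves the `Q`-adic valuation**: for
`τ : F ≃ₐ[ℚ] F` with `τ r ∈ Q ↔ r ∈ Q` on `𝓞 F`, `w (τ z) = w z` for all `z ∈ F`. [folklore] -/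
theorem adicValNNReal_smul_eq (τ : F ≃ₐ[ℚ] F)
    (hτQ : ∀ r : 𝓞 F, (τ • r : 𝓞 F) ∈ Q ↔ r ∈ Q) (z : F) :
    adicValNNReal Q (τ z) = adicValNNReal Q z := by
  set v := spectrumOfMaximal Q
  -- the ring automorphism of `𝓞 F` induced by `τ`
  set e : 𝓞 F ≃+* 𝓞 F := MulSemiringAction.toRingEquiv (F ≃ₐ[ℚ] F) (𝓞 F) τ with he
  have he_apply : ∀ r : 𝓞 F, ((e r : 𝓞 F) : F) = τ r := fun r => rfl
  have heQ : ∀ r, e r ∈ Q ↔ r ∈ Q := hτQ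
  -- write `z = n / d`
  obtain ⟨n, d, hd, rfl⟩ := IsFractionRing.div_surjective (A := 𝓞 F) z
  have key : (spectrumOfMaximal Q).valuation F (τ (algebraMap (𝓞 F) F n / algebraMap (𝓞 F) F d)) =
      (spectrumOfMaximal Q).valuation F (algebraMap (𝓞 F) F n / algebraMap (𝓞 F) F d) := by
    rw [map_div₀ τ, map_div₀, map_div₀,
      show τ (algebraMap (𝓞 F) F n) = ((e n : 𝓞 F) : F) from (he_apply n).symm,
      show ((e n : 𝓞 F) : F) = algebraMap (𝓞 F) F (e n) from rfl,
      show τ (algebraMap (𝓞 F) F d) = ((e d : 𝓞 F) : F) from (he_apply d).symm,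
      show ((e d : 𝓞 F) : F) = algebraMap (𝓞 F) F (e d) from rfl,
      HeightOneSpectrum.valuation_of_algebraMap, HeightOneSpectrum.valuation_of_algebraMap,
      HeightOneSpectrum.valuation_of_algebraMap, HeightOneSpectrum.valuation_of_algebraMap,
      intValuation_ringEquiv_eq Q e heQ, intValuation_ringEquiv_eq Q e heQ]
  rw [adicValNNReal_apply, adicValNNReal_apply, key]

/-! ### Inertia elements are inertial for the valuation -/

omit [Q.IsMaximal] in
/-- An element of the inertia group of `Q` stabilises `Q`: `τ r ∈ Q ↔ r ∈ Q`. [folklore] -/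
theorem smul_mem_iff_of_mem_inertia {τ : F ≃ₐ[ℚ] F} (hτ : τ ∈ Q.inertia (F ≃ₐ[ℚ] F))
    (r : 𝓞 F) : (τ • r : 𝓞 F) ∈ Q ↔ r ∈ Q := by
  have h1 : ∀ (g : F ≃ₐ[ℚ] F), g ∈ Q.inertia (F ≃ₐ[ℚ] F) → ∀ r : 𝓞 F, r ∈ Q → (g • r : 𝓞 F) ∈ Q := by
    intro g hg r hr
    have := hg r
    rw [show (g • r : 𝓞 F) = (g • r - r) + r by abel]
    exact Q.add_mem this hr
  refine ⟨fun h => ?_, h1 τ hτ r⟩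
  have := h1 τ⁻¹ (Subgroup.inv_mem _ hτ) (τ • r) h
  rwa [inv_smul_smul] at this

/-- **Inertia elements are inertial for the `Q`-adic valuation**: if `τ x - x ∈ Q` for all
`x ∈ 𝓞 F`, then `w (τ z - z) < 1` for every `z ∈ F` with `w z ≤ 1` (write `z = n/d` with
`d ∉ Q`, Mathlib `exists_primeCompl_mul_eq_of_integer`; then
`τ z - z = ((τ n - n) d - n (τ d - d))/(τ d · d)`). [folklore] -/
theorem adicValNNReal_smul_sub_lt_one {τ : F ≃ₐ[ℚ] F} (hτ : τ ∈ Q.inertia (F ≃ₐ[ℚ] F))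
    {z : F} (hz : adicValNNReal Q z ≤ 1) : adicValNNReal Q (τ z - z) < 1 := by
  set w := adicValNNReal Q with hw
  have hτQ := smul_mem_iff_of_mem_inertia Q hτ
  obtain ⟨n, d, hnd⟩ := (spectrumOfMaximal Q).exists_primeCompl_mul_eq_of_integer z
    ((adicValNNReal_le_one_iff Q z).mp hz)
  set dd : 𝓞 F := (d : 𝓞 F) with hdd
  have hdQ : dd ∉ Q := d.2
  have hwd : w (dd : F) = 1 := by
    refine le_antisymm (adicValNNReal_coe_le_one Q dd) (not_lt.mp fun hlt => hdQ ?_)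
    exact (adicValNNReal_coe_lt_one_iff Q dd).mp hlt
  have hd0 : (dd : F) ≠ 0 := fun h0 => by rw [h0, map_zero] at hwd; exact zero_ne_one hwd
  have hwτd : w (τ (dd : F)) = 1 := by rw [hw, adicValNNReal_smul_eq Q τ hτQ]; exact hwd
  have hτd0 : τ (dd : F) ≠ 0 := fun h0 => by rw [h0, map_zero] at hwτd; exact zero_ne_one hwτd
  -- `z = n / d`
  have hz' : z = (n : F) / (dd : F) := by
    rw [eq_div_iff hd0]; exact hnd
  -- the numerator identity
  have hnum : τ z - z = ((τ (n : F) - n) * dd - n * (τ (dd : F) - dd)) / (τ (dd : F) * dd) := by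
    rw [hz', map_div₀]
    field_simp
    ring
  have hsmall : ∀ r : 𝓞 F, w (τ (r : F) - r) < 1 := fun r => by
    have h1 : (τ • r - r : 𝓞 F) ∈ Q := hτ r
    rw [← adicValNNReal_coe_lt_one_iff Q] at h1
    have e : ((τ • r - r : 𝓞 F) : F) = τ (r : F) - r := by
      rw [RingOfIntegers.coe_eq_algebraMap, map_sub]; rfl
    rw [e] at h1
    exact h1
  rw [hnum, map_div₀, Valuation.map_mul, hwτd, hwd, one_mul, div_one]
  refine (Valuation.map_sub w _ _).trans_lt (max_lt ?_ ?_)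
  · rw [Valuation.map_mul, hwd, mul_one]; exact hsmall n
  · rw [Valuation.map_mul]
    calc w (n : F) * w (τ (dd : F) - dd) ≤ 1 * w (τ (dd : F) - dd) := by
          gcongr; exact adicValNNReal_coe_le_one Q n
      _ < 1 := by rw [one_mul]; exact hsmall dd

/-- At most one rational prime lies below `Q`: `w p < 1` for the prime `p` under `Q`, and then
`w 11 < 1` forces `p = 11`; here in the form used downstream: `w (11 : F) ≤ 1`, with
`w (11 : F) = 1` unless `11 ∈ Q`. [folklore] -/
theorem adicValNNReal_natCast_lt_one_iff (p : ℕ) : adicValNNReal Q (p : F) < 1 ↔ (p : 𝓞 F) ∈ Q := by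
  rw [show ((p : ℕ) : F) = ((p : 𝓞 F) : F) by simp, adicValNNReal_coe_lt_one_iff]

end NumberFieldValuation

/-! ### A valuation with `w p < 1` restricted to `ℚ` -/

section RatValues

variable {L : Type*} [Field L] [CharZero L] (w : Valuation L ℝ≥0) {p : ℕ} (hp : p.Prime)
  (hwp : w (p : L) < 1)
include hp hwp

/-- **`w n < 1 ↔ p ∣ n` on `ℤ`** for a valuation with `w p < 1` (Bézout: if `p ∤ n` then
`a n + b p = 1`). [folklore] -/
theorem val_intCast_lt_one_iff_dvd (n : ℤ) : w (n : L) < 1 ↔ (p : ℤ) ∣ n := by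
  constructor
  · intro hlt
    by_contra hnd
    have hcop : IsCoprime n (p : ℤ) :=
      ((Irreducible.coprime_iff_not_dvd (Nat.prime_iff_prime_int.1 hp).irreducible).mpr hnd).symm
    obtain ⟨a, b, hab⟩ := hcop
    have h1 : w (1 : L) < 1 := by
      have e : (1 : L) = (a : L) * n + (b : L) * p := by exact_mod_cast congrArg (Int.cast (R := L)) hab.symm
      rw [e]
      refine (Valuation.map_add w _ _).trans_lt (max_lt ?_ ?_)
      · rw [Valuation.map_mul]
        calc w (a : L) * w (n : L) ≤ 1 * w (n : L) := by gcongr; exact val_intCast_le_one w a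
          _ < 1 := by rw [one_mul]; exact hlt
      · rw [Valuation.map_mul]
        calc w (b : L) * w (p : L) ≤ 1 * w (p : L) := by gcongr; exact val_intCast_le_one w b
          _ < 1 := by rw [one_mul]; exact hwp
    simp at h1
  · rintro ⟨k, rfl⟩
    rw [Int.cast_mul, Int.cast_natCast, Valuation.map_mul]
    calc w (p : L) * w (k : L) ≤ w (p : L) * 1 := by gcongr; exact val_intCast_le_one w k
      _ < 1 := by rw [mul_one]; exact hwp

/-- **Reading `x ≡ c (mod p)` for a rational `x` off a valuation**: if `w x ≤ 1` and
`w (x - c) < 1` (`c ∈ ℤ`) then `p ∤ den x` and `p ∣ num x - c · den x`. [folklore] -/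
theorem not_dvd_den_and_dvd_of_val (x : ℚ) (c : ℤ) (hx : w (x : L) ≤ 1)
    (hxc : w ((x : L) - c) < 1) : ¬ (p : ℤ) ∣ x.den ∧ (p : ℤ) ∣ x.num - c * x.den := by
  have hD0 : ((x.den : ℕ) : L) ≠ 0 := by exact_mod_cast x.den_nz
  have hxeq : (x : L) = (x.num : L) / (x.den : L) := Rat.cast_def x
  have hN : w ((x.num : ℤ) : L) ≤ 1 := val_intCast_le_one w _
  have hD : w ((x.den : ℕ) : L) ≤ 1 := val_natCast_le_one w _
  have hiffD : w ((x.den : ℕ) : L) < 1 ↔ (p : ℤ) ∣ x.den := by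
    rw [← Int.cast_natCast]; exact val_intCast_lt_one_iff_dvd w hp hwp _
  have hpD : ¬ (p : ℤ) ∣ x.den := by
    intro hpd
    have hpN : ¬ (p : ℤ) ∣ x.num := fun hpn => by
      have h1 : (p : ℤ) ∣ (Int.gcd x.num x.den : ℤ) := Int.dvd_coe_gcd hpn hpd
      rw [show Int.gcd x.num (x.den : ℤ) = 1 from x.reduced] at h1
      exact hp.one_lt.ne' (by exact_mod_cast Int.eq_one_of_dvd_one (by positivity) h1)
    have hwN : w ((x.num : ℤ) : L) = 1 :=
      le_antisymm hN (not_lt.mp fun hlt => hpN ((val_intCast_lt_one_iff_dvd w hp hwp _).mp hlt))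
    have hwD : w ((x.den : ℕ) : L) < 1 := hiffD.mpr hpd
    have : 1 < w (x : L) := by
      rw [hxeq, map_div₀, hwN, one_div, one_lt_inv₀ ((map_ne_zero w).mpr hD0 |> pos_iff_ne_zero.mpr)]
      exact hwD
    exact absurd hx (not_le.mpr this)
  have hwD : w ((x.den : ℕ) : L) = 1 := le_antisymm hD (not_lt.mp fun hlt => hpD (hiffD.mp hlt))
  refine ⟨hpD, (val_intCast_lt_one_iff_dvd w hp hwp _).mp ?_⟩
  have e : (((x.num - c * x.den : ℤ)) : L) = ((x : L) - c) * ((x.den : ℕ) : L) := by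
    rw [hxeq]; field_simp; push_cast; ring
  rw [e, Valuation.map_mul, hwD, mul_one]
  exact hxc

end RatValues

end Literature.NumberTheory.EllipticCurves.X1Eleven

end
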